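import Mathlib
import Literature.NumberTheory.Automorphic.HigherGreenFunctionProofs2
import Literature.NumberTheory.Automorphic.HigherGreenFunctionProofs4

/-!
# Higher Green functions, layer 0 (continued): the closed form `Q_n = P_n Q_0 - W_{n-1}`

Fifth proved companion file of `Literature/NumberTheory/Automorphic/HigherGreenFunction.lean`
(the Gross–Zagier algebraicity conjecture `GKZAlgebraicity`, Bruinier–Li–Yang 2025, Conjecture 1.1 /
Theorem 1.4). The kernel of the higher Green function `G_s` of (1.1) is Heine's integral
`Q_{s-1}(t) = greenQ s t`; `HigherGreenFunctionProofs2.lean` proved Bonnet's three-term recursion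
for it (`greenQ_three_term`) and the closed forms of `Q_0`, `Q_1` (`greenQ_one_eq`, `greenQ_two_eq`).
Here:

* `exists_legendre_closedForm`: **for every `n` there are `P_n, W_{n-1} ∈ ℚ[X]` with
  `Q_n(t) = P_n(t) Q_0(t) - W_{n-1}(t)` (`t > 1`)**, `P_n` the Legendre polynomial — recorded
  def-free by its properties: `P_n(1) = 1`, `deg P_n = n` with positive leading coefficient, parity
  `P_n(-x) = (-1)ⁿ P_n(x)`; `deg W_{n-1} ≤ n - 1`, parity `n - 1` — all three sequences satisfying
  Bonnet's recursion `(n+1)R_{n+1} = (2n+1)XR_n - nR_{n-1}` (Jeffrey, *Handbook of Mathematical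
  Formulas and Integrals*, §18.2.5.1 (1) and §18.2.7: "the functions `Q_n(x)` … satisfy the same
  recurrence relations as those for `P_n(x)`", with `Q_0, …, Q_5` listed); together with the
  `√D`-scaling rationality `(√D)ⁿ P_n(q/√D), (√D)^{n+1} W_{n-1}(q/√D) ∈ ℚ` (`q ∈ ℚ`, `D ∈ ℚ_{>0}`).
  (`exists_greenQ_eq_poly_mul_log_sub_poly`: the same with `Q_0 = ½ log((t+1)/(t-1))` written out.)
  The tree's `Literature.Analysis.SpecialFunctions.legendre n ∈ ℝ[X]` is `P_n` through Rodrigues'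
  formula (degree, leading coefficient, orthogonality); the identification with the `P` here
  (Bonnet's recursion for Rodrigues' formula) is classical and not needed below.
* `exists_rat_greenQ_div_sqrt_eq`: hence `Q_n(q/√D) = (√D)^{-n}(S · ½ log((q+√D)/(q-√D)) - V/√D)`
  with `S, V ∈ ℚ` for rational `q > √D`;
* `IsCMPointOfDisc.exists_rat_greenQ_cosh_dist_smul_eq`: **the terms of `G_s^{Γ₀(N),m}(z₁, z₂)`
  ((1.1)–(1.2)) at CM points `zⱼ` of discriminants `dⱼ`** — by
  `IsCMPointOfDisc.exists_int_eq_cosh_dist_smul` (`HigherGreenFunctionProofs4.lean`) the argument is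
  `cosh d(z₁, γz₂) = k/(m√(d₁d₂))`, `k ∈ ℤ`, so for `s = n + 1` each term `Q_n(cosh d(z₁, γz₂))`,
  `γz₂ ≠ z₁`, equals `|d₁d₂|^{-n/2}(S · ½ log((k + m√(d₁d₂))/(k - m√(d₁d₂))) - V/√(d₁d₂))`,
  `S, V ∈ ℚ`: a rational multiple of `|d₁d₂|^{-n/2}` times the logarithm of an element of
  `ℚ(√(d₁d₂))`, plus a rational multiple of `|d₁d₂|^{-(n+1)/2}` — term by term the shape of the right
  hand side of Conjecture 1.1 (`|d₁d₂|^{-r/2} log|α|`, `r = n`) up to the additive rational part,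
  which of course proves nothing about the infinite sum.

## References

* J. H. Bruinier, Y. Li, T. Yang, *Deformations of theta integrals and a conjecture of
  Gross–Zagier*, Forum Math. Sigma 13 (2025), arXiv:2204.10604, (1.1)–(1.2), Conj. 1.1.
  [`BruinierLiYang2025`]
* A. Jeffrey, *Handbook of Mathematical Formulas and Integrals*, Academic Press 1995,
  doi:10.1016/c2009-0-21270-0, §18.2.4–§18.2.7 (Legendre polynomials, recurrence relations,
  Legendre functions of the second kind). [`Jeffrey1995`]
-/

noncomputable section

namespace Literature.NumberTheory.Automorphic

open Polynomial Real UpperHalfPlane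

/-- `Q_0(q/E) = ½ log((q + E)/(q - E))` for `q > E > 0`. [folklore] -/
theorem greenQ_one_div_eq_log {q E : ℝ} (hE : 0 < E) (hq : E < q) :
    greenQ 1 (q / E) = Real.log ((q + E) / (q - E)) / 2 := by
  rw [greenQ_one_eq (by rwa [lt_div_iff₀ hE, one_mul])]
  congr 2
  have hqE : q - E ≠ 0 := by linarith
  field_simp

/-- The two-level induction behind `exists_legendre_closedForm`: Bonnet's recursion
`(n+2) R_{n+2} = (2n+3) X R_{n+1} - (n+1) R_n` run simultaneously for `P_n`, `W_{n-1}` and all the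
listed properties (closed form from `greenQ_three_term`; normalisation, degree, parity and the
`√D`-scaling rationality are stable under the recursion). [folklore] -/
private theorem legendre_pair (n : ℕ) : ∃ P W P₁ W₁ : ℚ[X],
    ((∀ t : ℝ, 1 < t → greenQ (n + 1) t = aeval t P * greenQ 1 t - aeval t W) ∧
      P.eval 1 = 1 ∧ (P.natDegree = n ∧ 0 < P.leadingCoeff) ∧ W.natDegree + 1 ≤ max n 1 ∧
      (∀ x : ℝ, aeval (-x) P = (-1) ^ n * aeval x P) ∧
      (∀ x : ℝ, aeval (-x) W = (-1) ^ (n + 1) * aeval x W) ∧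
      (∀ q D : ℚ, 0 < D → ∃ u : ℚ, Real.sqrt D ^ n * aeval ((q : ℝ) / Real.sqrt D) P = u) ∧
      (∀ q D : ℚ, 0 < D → ∃ u : ℚ, Real.sqrt D ^ (n + 1) * aeval ((q : ℝ) / Real.sqrt D) W = u)) ∧
    ((∀ t : ℝ, 1 < t → greenQ (n + 2) t = aeval t P₁ * greenQ 1 t - aeval t W₁) ∧
      P₁.eval 1 = 1 ∧ (P₁.natDegree = n + 1 ∧ 0 < P₁.leadingCoeff) ∧ W₁.natDegree + 1 ≤ n + 1 ∧
      (∀ x : ℝ, aeval (-x) P₁ = (-1) ^ (n + 1) * aeval x P₁) ∧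
      (∀ x : ℝ, aeval (-x) W₁ = (-1) ^ (n + 2) * aeval x W₁) ∧
      (∀ q D : ℚ, 0 < D → ∃ u : ℚ, Real.sqrt D ^ (n + 1) * aeval ((q : ℝ) / Real.sqrt D) P₁ = u) ∧
      (∀ q D : ℚ, 0 < D → ∃ u : ℚ, Real.sqrt D ^ (n + 2) * aeval ((q : ℝ) / Real.sqrt D) W₁ = u)) := by
  induction n with
  | zero =>
    refine ⟨1, 0, X, 1, ⟨?_, by simp, by simp, by simp, by simp, by simp, ?_, ?_⟩,
      ⟨?_, by simp, by simp, by simp, by simp, by simp, ?_, ?_⟩⟩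
    · intro t ht; simp
    · intro q D hD; exact ⟨1, by simp⟩
    · intro q D hD; exact ⟨0, by simp⟩
    · intro t ht
      rw [greenQ_two_eq ht, greenQ_one_eq ht]
      simp
    · intro q D hD
      have hs : 0 < Real.sqrt D := Real.sqrt_pos.mpr (by exact_mod_cast hD)
      exact ⟨q, by simp; field_simp⟩
    · intro q D hD
      exact ⟨D, by simp [Real.sq_sqrt (show (0:ℝ) ≤ D by exact_mod_cast hD.le)]⟩
  | succ n ih =>
    obtain ⟨P, W, P₁, W₁, ⟨hcf, hone, hdeg, hWdeg, hpar, hWpar, hsc, hWsc⟩,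
      ⟨hcf₁, hone₁, hdeg₁, hWdeg₁, hpar₁, hWpar₁, hsc₁, hWsc₁⟩⟩ := ih
    -- Bonnet's recursion
    set a : ℚ := (2 * n + 3 : ℚ) / (n + 2) with ha
    set b : ℚ := (n + 1 : ℚ) / (n + 2) with hb
    have ha0 : 0 < a := by rw [ha]; positivity
    set P₂ : ℚ[X] := C a * X * P₁ - C b * P with hP₂
    set W₂ : ℚ[X] := C a * X * W₁ - C b * W with hW₂
    refine ⟨P₁, W₁, P₂, W₂, ⟨hcf₁, hone₁, hdeg₁, by omega, hpar₁, hWpar₁, hsc₁, hWsc₁⟩,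
      ⟨?_, ?_, ?_, ?_, ?_, ?_, ?_, ?_⟩⟩
    · -- closed form at level `n + 2`, from the three-term recurrence
      intro t ht
      have h3 := greenQ_three_term ht (s := n + 1) (by omega)
      rw [hcf t ht, hcf₁ t ht] at h3
      push_cast at h3
      rw [show n + 1 + 2 = n + 3 from rfl] at h3
      rw [show n + 1 + 2 = n + 3 from rfl, hP₂, hW₂]
      simp only [map_sub, map_mul, aeval_C, aeval_X, eq_ratCast, ha, hb]
      have hn : (n : ℝ) + 2 ≠ 0 := by positivity
      push_cast
      field_simp
      linear_combination h3
    · -- normalisation `P(1) = 1`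
      rw [hP₂]
      simp only [eval_sub, eval_mul, eval_C, eval_X, hone, hone₁, mul_one, ha, hb]
      have : (n : ℚ) + 2 ≠ 0 := by positivity
      field_simp
      ring
    · -- degree and leading coefficient
      have hP1ne : P₁ ≠ 0 := fun h => by rw [h] at hdeg₁; simp at hdeg₁
      set p : ℚ[X] := C a * X * P₁ with hp
      set q : ℚ[X] := C b * P with hq
      have hpdeg : p.natDegree = n + 2 := by
        rw [hp, mul_assoc, natDegree_C_mul ha0.ne', natDegree_X_mul hP1ne, hdeg₁.1]
      have hplc : p.leadingCoeff = a * P₁.leadingCoeff := by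
        rw [hp, leadingCoeff_mul, leadingCoeff_mul, leadingCoeff_C, leadingCoeff_X, mul_one]
      have hqdeg : q.natDegree ≤ n := by
        rw [hq]
        exact (natDegree_C_mul_le _ _).trans hdeg.1.le
      have hlt : q.natDegree < p.natDegree := by rw [hpdeg]; omega
      rw [hP₂]
      refine ⟨?_, ?_⟩
      · rw [natDegree_sub_eq_left_of_natDegree_lt hlt, hpdeg]
      · rw [leadingCoeff_sub_of_degree_lt (degree_lt_degree hlt), hplc]
        exact mul_pos ha0 hdeg₁.2
    · -- degree of `W`
      rw [hW₂]
      have h1 : (C a * X * W₁).natDegree ≤ n + 1 := by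
        refine natDegree_mul_le.trans ?_
        have : (C a * X : ℚ[X]).natDegree ≤ 1 := (natDegree_C_mul_le _ _).trans natDegree_X_le
        omega
      have h2 : (C b * W).natDegree ≤ n + 1 := by
        refine (natDegree_C_mul_le _ _).trans ?_
        omega
      have := natDegree_sub_le_of_le h1 h2
      omega
    · -- parity of `P`
      intro x
      rw [hP₂]
      simp only [map_sub, map_mul, aeval_C, aeval_X, hpar x, hpar₁ x]
      ring
    · -- parity of `W`
      intro x
      rw [hW₂]
      simp only [map_sub, map_mul, aeval_C, aeval_X, hWpar x, hWpar₁ x]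
      ring
    · -- scaling of `P`
      intro q D hD
      have hs : 0 < Real.sqrt D := Real.sqrt_pos.mpr (by exact_mod_cast hD)
      have hs2 : Real.sqrt D ^ 2 = (D : ℝ) := Real.sq_sqrt (by exact_mod_cast hD.le)
      obtain ⟨u0, hu0⟩ := hsc q D hD
      obtain ⟨u1, hu1⟩ := hsc₁ q D hD
      refine ⟨a * q * u1 - b * D * u0, ?_⟩
      rw [hP₂]
      simp only [map_sub, map_mul, aeval_C, aeval_X, eq_ratCast]
      push_cast
      rw [← hu0, ← hu1]
      rw [show Real.sqrt D ^ (n + 2) = Real.sqrt D ^ n * Real.sqrt D ^ 2 by ring, hs2,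
        show Real.sqrt D ^ (n + 1) = Real.sqrt D ^ n * Real.sqrt D by ring]
      field_simp
      linear_combination (-((a : ℝ) * q * aeval ((q : ℝ) / Real.sqrt D) P₁)) * hs2
    · -- scaling of `W`
      intro q D hD
      have hs : 0 < Real.sqrt D := Real.sqrt_pos.mpr (by exact_mod_cast hD)
      have hs2 : Real.sqrt D ^ 2 = (D : ℝ) := Real.sq_sqrt (by exact_mod_cast hD.le)
      obtain ⟨u0, hu0⟩ := hWsc q D hD
      obtain ⟨u1, hu1⟩ := hWsc₁ q D hD
      refine ⟨a * q * u1 - b * D * u0, ?_⟩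
      rw [hW₂]
      simp only [map_sub, map_mul, aeval_C, aeval_X, eq_ratCast]
      push_cast
      rw [← hu0, ← hu1]
      rw [show Real.sqrt D ^ (n + 2 + 1) = Real.sqrt D ^ (n + 1) * Real.sqrt D ^ 2 by ring, hs2,
        show Real.sqrt D ^ (n + 1 + 1) = Real.sqrt D ^ (n + 1) * Real.sqrt D by ring]
      field_simp
      linear_combination (-((a : ℝ) * q * aeval ((q : ℝ) / Real.sqrt D) W₁)) * hs2

/-- **Closed form of the Legendre functions of the second kind of integral degree** (def-free
form). For every `n ≥ 0` there are `P, W ∈ ℚ[X]` — the Legendre polynomial `P = P_n`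
(`P(1) = 1`, `deg P = n`, positive leading coefficient, parity `n`) and `W = W_{n-1}`
(`deg W ≤ n - 1`, parity `n - 1`) — with
`Q_n(t) = P_n(t) Q_0(t) - W_{n-1}(t)` for `t > 1`, `Q_0(t) = ½ log((t+1)/(t-1))`,
where `Q_n(t) = greenQ (n+1) t` is Heine's integral ((1.1) of Bruinier–Li–Yang 2025): all of
`Q_n`, `P_n Q_0`, `W_{n-1}` satisfy Bonnet's recursion `(n+1)R_{n+1} = (2n+1)tR_n - nR_{n-1}`
(`greenQ_three_term`; "the functions `Q_n(x)` satisfy the same recurrence relations as those for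
`P_n(x)`"), with `Q_1 = tQ_0 - 1` (`greenQ_two_eq`); e.g. `Q_2 = ¼(3t²-1) log((t+1)/(t-1)) - 3t/2`.
Moreover `(√D)ⁿ P(q/√D), (√D)^{n+1} W(q/√D) ∈ ℚ` for `q ∈ ℚ`, `D ∈ ℚ_{>0}` (parity). (The tree's
`Literature.Analysis.SpecialFunctions.legendre n ∈ ℝ[X]` is `P_n` by Rodrigues' formula; the
identification is not needed here.) [cite: Jeffrey1995, §18.2.5.1 (1) and §18.2.7] -/
theorem exists_legendre_closedForm (n : ℕ) : ∃ P W : ℚ[X],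
    (∀ t : ℝ, 1 < t → greenQ (n + 1) t = aeval t P * greenQ 1 t - aeval t W) ∧
      P.eval 1 = 1 ∧ (P.natDegree = n ∧ 0 < P.leadingCoeff) ∧ W.natDegree + 1 ≤ max n 1 ∧
      (∀ x : ℝ, aeval (-x) P = (-1) ^ n * aeval x P) ∧
      (∀ x : ℝ, aeval (-x) W = (-1) ^ (n + 1) * aeval x W) ∧
      (∀ q D : ℚ, 0 < D → ∃ u : ℚ, Real.sqrt D ^ n * aeval ((q : ℝ) / Real.sqrt D) P = u) ∧
      (∀ q D : ℚ, 0 < D → ∃ u : ℚ, Real.sqrt D ^ (n + 1) * aeval ((q : ℝ) / Real.sqrt D) W = u) := by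
  obtain ⟨P, W, -, -, h, -⟩ := legendre_pair n
  exact ⟨P, W, h⟩

/-- The closed form with the logarithm written out: `Q_n(t) = P_n(t) · ½ log((t+1)/(t-1)) - W_{n-1}(t)`
(`t > 1`), `P_n, W_{n-1} ∈ ℚ[X]` of degrees `n`, `≤ n - 1`. [cite: Jeffrey1995, §18.2.7] -/
theorem exists_greenQ_eq_poly_mul_log_sub_poly (n : ℕ) : ∃ P W : ℚ[X],
    P.natDegree = n ∧ W.natDegree + 1 ≤ max n 1 ∧
    ∀ t : ℝ, 1 < t → greenQ (n + 1) t =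
      aeval t P * (Real.log ((t + 1) / (t - 1)) / 2) - aeval t W := by
  obtain ⟨P, W, hcf, -, hdeg, hWdeg, -⟩ := exists_legendre_closedForm n
  exact ⟨P, W, hdeg.1, hWdeg, fun t ht => by rw [hcf t ht, greenQ_one_eq ht]⟩

/-- **The values `Q_n(q/√D)`** (`q ∈ ℚ`, `D ∈ ℚ_{>0}`, `q > √D`):
`Q_n(q/√D) = (√D)^{-n} (S · ½ log((q + √D)/(q - √D)) - V/√D)` with `S, V ∈ ℚ`
(`S = (√D)ⁿ P_n(q/√D)`, `V = (√D)^{n+1} W_{n-1}(q/√D)`). [folklore] -/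
theorem exists_rat_greenQ_div_sqrt_eq (q D : ℚ) (hD : 0 < D) (hq : Real.sqrt D < q) (n : ℕ) :
    ∃ S V : ℚ, greenQ (n + 1) ((q : ℝ) / Real.sqrt D) =
      (Real.sqrt D ^ n)⁻¹ * (S * (Real.log (((q : ℝ) + Real.sqrt D) / ((q : ℝ) - Real.sqrt D)) / 2) -
        V / Real.sqrt D) := by
  have hs : 0 < Real.sqrt D := Real.sqrt_pos.mpr (by exact_mod_cast hD)
  obtain ⟨P, W, hcf, -, -, -, -, -, hsc, hWsc⟩ := exists_legendre_closedForm n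
  obtain ⟨S, hS⟩ := hsc q D hD
  obtain ⟨V, hV⟩ := hWsc q D hD
  refine ⟨S, V, ?_⟩
  rw [hcf _ (by rwa [lt_div_iff₀ hs, one_mul]), greenQ_one_div_eq_log hs hq, ← hS, ← hV]
  have hsn : Real.sqrt D ^ n ≠ 0 := pow_ne_zero _ hs.ne'
  field_simp
  ring

/-- **The terms of `G_s^{Γ₀(N),m}(z₁, z₂)` at CM points** (Bruinier–Li–Yang 2025, (1.1)–(1.2)):
for CM points `zⱼ` of discriminants `dⱼ`, `γ ∈ R_N^{(m)}` (`m ≥ 1`) with `γz₂ ≠ z₁` and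
`s = n + 1 ≥ 1`, the term `Q_n(cosh d(z₁, γz₂))` equals
`|d₁d₂|^{-n/2} (S · ½ log((k + m√(d₁d₂))/(k - m√(d₁d₂))) - V/√(d₁d₂))`
with `S, V ∈ ℚ` and `k = m cosh d(z₁, γz₂) √(d₁d₂) ∈ ℤ` (`IsCMPointOfDisc.exists_int_eq_cosh_dist_smul`,
`exists_rat_greenQ_div_sqrt_eq`): a rational multiple of `|d₁d₂|^{-n/2}` times the logarithm of
the element `(k + m√(d₁d₂))/(k - m√(d₁d₂))` of `ℚ(√(d₁d₂))`, plus a rational multiple of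
`|d₁d₂|^{-(n+1)/2}`. (Each term of (1.1)–(1.3) at a CM point thus has the shape of the right
hand side of Conjecture 1.1 up to the additive rational part; the series being infinite, this
proves nothing about the sum.) [folklore] -/
theorem IsCMPointOfDisc.exists_rat_greenQ_cosh_dist_smul_eq {N : ℕ} {m : ℤ} (hm : 0 < m)
    {γ : Matrix (Fin 2) (Fin 2) ℤ} (hγ : γ ∈ heckeMatrices N m) {z₁ z₂ : ℍ} {d₁ d₂ : ℤ}
    (h₁ : IsCMPointOfDisc z₁ d₁) (h₂ : IsCMPointOfDisc z₂ d₂)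
    (hne : Literature.NumberTheory.EllipticCurves.ModularForms.intGL γ • z₂ ≠ z₁) (n : ℕ) :
    ∃ (k : ℤ) (S V : ℚ), (m : ℝ) * Real.sqrt ((d₁ * d₂ : ℤ) : ℝ) < k ∧
      greenQ (n + 1) (Real.cosh (dist z₁ (Literature.NumberTheory.EllipticCurves.ModularForms.intGL γ • z₂))) =
        (Real.sqrt ((d₁ * d₂ : ℤ) : ℝ) ^ n)⁻¹ *
          (S * (Real.log (((k : ℝ) + m * Real.sqrt ((d₁ * d₂ : ℤ) : ℝ)) /
            ((k : ℝ) - m * Real.sqrt ((d₁ * d₂ : ℤ) : ℝ))) / 2) - V / Real.sqrt ((d₁ * d₂ : ℤ) : ℝ)) := by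
  set D : ℚ := ((d₁ * d₂ : ℤ) : ℚ) with hDdef
  set E : ℝ := Real.sqrt ((d₁ * d₂ : ℤ) : ℝ) with hEdef
  have hDpos : 0 < D := by rw [hDdef]; exact_mod_cast h₁.mul_disc_pos h₂
  have hDcast : ((d₁ * d₂ : ℤ) : ℝ) = (D : ℝ) := by rw [hDdef, Rat.cast_intCast]
  have hsqrtD : Real.sqrt (D : ℝ) = E := by rw [hEdef, hDcast]
  obtain ⟨k, hk, -⟩ := h₁.exists_int_eq_cosh_dist_smul hm hγ h₂
  have hE : 0 < E := Real.sqrt_pos.mpr (by exact_mod_cast h₁.mul_disc_pos h₂)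
  have hm0 : (0 : ℝ) < m := by exact_mod_cast hm
  set t : ℝ := Real.cosh (dist z₁ (Literature.NumberTheory.EllipticCurves.ModularForms.intGL γ • z₂)) with ht
  have ht1 : 1 < t := Real.one_lt_cosh.mpr (dist_ne_zero.mpr hne.symm)
  -- `k > m E` and `t = (k/m)/E`
  have hmEk : (m : ℝ) * E < k := by
    calc (m : ℝ) * E = m * (1 * E) := by ring
      _ < m * (t * E) := by gcongr
      _ = k := hk
  have htq : t = ((k : ℝ) / m) / E := by
    field_simp
    linear_combination hk
  have hqcast : (((k : ℚ) / m : ℚ) : ℝ) = (k : ℝ) / m := by push_cast; ring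
  have hlt : Real.sqrt (D : ℝ) < (((k : ℚ) / m : ℚ) : ℝ) := by
    rw [hsqrtD, hqcast, lt_div_iff₀ hm0]
    linarith
  obtain ⟨S, V, hSV⟩ := exists_rat_greenQ_div_sqrt_eq ((k : ℚ) / m) D hDpos hlt n
  rw [hsqrtD, hqcast] at hSV
  refine ⟨k, S, V, hmEk, ?_⟩
  rw [htq, hSV]
  have hm' : (m : ℝ) ≠ 0 := hm0.ne'
  have h1 : (k : ℝ) / m + E = ((k : ℝ) + m * E) / m := by field_simp
  have h2 : (k : ℝ) / m - E = ((k : ℝ) - m * E) / m := by field_simp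
  rw [h1, h2, div_div_div_cancel_right₀ hm']

end Literature.NumberTheory.Automorphic
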